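import Summits.MatrixMultiplication.MatrixMultiplication.Theses.CondensationDistance
import Summits.MatrixMultiplication.MatrixMultiplication.Theorems.CondensationDistanceCondensationSound
import Summits.MatrixMultiplication.MatrixMultiplication.Theorems.CondensationDistanceDerivationsBoundOmega
import Summits.MatrixMultiplication.MatrixMultiplication.Theorems.CondensationDistanceTransportToTight
import Summits.MatrixMultiplication.MatrixMultiplication.Theorems.CondensationDistanceTightToShort

/-!
# `ShortCondensation` is summit-strength (crux-strategist r1, stmt-MatrixMultiplication-15936)

Route `MatrixMultiplication/CondensationDistance`, deciding theorem
`closes : ShortCondensation → CondensationSound → DerivationsBoundOmega → MatrixMultiplication`.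
Both companion cruxes are now LANDED theorems of the tree
(`CondensationSound_of`, stmt-15939, and `DerivationsBoundOmega_of`, stmt-15940), so the one open crux
`X := ShortCondensation` implies the summit `S := MatrixMultiplication` (ω(ℂ) = 2) OUTRIGHT, and so does
every registered sufficient condition for it, in particular the support items `TightCondensation`
(stmt-15937, via `TightToShort_proof`) and `CheapHalfTransport` (stmt-15938, via `TransportToTight_proof`);
the engine `stub_schurFrame` of line `schur` implies it too (landed `shortCondensation_of_schurFrame`; spelled
out in `Cruxes/ShortCondensation/StrategistR1.lean`).

This is the theorem that makes the crux summit-strength in the sense of the strategist protocol: any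
line / stub set for `X` is a line for `ω = 2` itself, and a decomposition `X₁ → … → X_k → X` whose pieces are
each strictly weaker than `S` would be a decomposition of the summit.  (The converse `S → X` is NOT claimed and
is believed false in spirit: `X` is `ω = 2` inside the restricted Plücker/condensation model.)  Sorry-free.
-/

set_option linter.dupNamespace false

namespace Summit.MatrixMultiplication.MatrixMultiplication.Theorems.ShortCondensation

open Summit.MatrixMultiplication.MatrixMultiplication.Theses.CondensationDistance
open Summit.MatrixMultiplication.MatrixMultiplication.Theorems.CondensationSound (CondensationSound_of)
open Summit.MatrixMultiplication.MatrixMultiplication.Theorems.DerivationsBoundOmega (DerivationsBoundOmega_of)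

/-- **Summit strength of the crux.** `ShortCondensation → MatrixMultiplication`, by the route's deciding
theorem `closes` fed with the two landed cruxes `CondensationSound_of` (BCS 1997 (4.4)/(4.7), three-term
Plücker relations as division steps) and `DerivationsBoundOmega_of` (BCS 1997 Thm. (16.7) + Andrews lifting).
[cite: BurgisserClausenShokrollahi1997, Thm. (16.7)] -/
theorem shortCondensation_implies_summit (hX : ShortCondensation) : _root_.MatrixMultiplication :=
  closes hX CondensationSound_of DerivationsBoundOmega_of

/-- `TightCondensation → MatrixMultiplication` (support item stmt-15937 is summit-strength too). [folklore] -/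
theorem tightCondensation_implies_summit (h : TightCondensation) : _root_.MatrixMultiplication :=
  shortCondensation_implies_summit (TightToShort_proof h)

/-- `CheapHalfTransport → MatrixMultiplication` (support item stmt-15938 is summit-strength too). [folklore] -/
theorem cheapHalfTransport_implies_summit (h : CheapHalfTransport) : _root_.MatrixMultiplication :=
  tightCondensation_implies_summit (TransportToTight_proof h)

end Summit.MatrixMultiplication.MatrixMultiplication.Theorems.ShortCondensation
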